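/-
Copyright (c) 2026 the pub-hodgecm-mathlib formalisation cell (harness21).  Prover seat hodgecm-mathlib-K2Liu-p01 (g5), Track B «K2-LIT»,
Road I organ (A-int)-fin, A2 «mixed-model equivariance of the Kudla–Rallis map `r_w`» — MODEL-INDEPENDENT bricks (LEAD F0P6-plan (g12) M-156g (ii),
M-156j (3): A2 priority, census-first while (β-1)/(β-2) are typed).  KERNEL: theorems only.
-/
import Summits.HodgeConjecture.HodgeConjecture.Theorems.K2LiuLocalMatrixHaarChar   -- ★ `addEquivAddHaarChar_mulVec_eq_normAbs`, `exists_continuousAddEquiv_mulVec`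
import Mathlib.MeasureTheory.Measure.Haar.MulEquivHaarChar
import Mathlib.MeasureTheory.Group.Integral
import HarnessLib

/-!
# Fibre integrals under block-triangular substitutions (the `P_Δ` ∕ `P_Y`-equivariance bookkeeping of the Kudla–Rallis map)

Cell `hodgecm-mathlib`, crux item hLiu418 = `stmt-HodgeConjecture-24832`; squad K2 ∕ K2Liu, prover K2Liu-p01 (g5).  THEOREMS ONLY (no `def`, no instance,
no notation, no named fact, no `sorry`); lane `--supports stmt-HodgeConjecture-24832 --as helper`.  Companion of ★ `K2LiuSchwartzBruhatFiberIntegral`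
(K2Liu-p09 (g4), p858160: the fibre integral `a ↦ ∫ f (Sum.elim a b) dμ(b)` of a Schwartz–Bruhat function is Schwartz–Bruhat).

The Kudla–Rallis ∕ mixed-model map of the Road I sheet is `r_w := (restrict to Y-rows = 0) ∘ (integrate the X-rows)` on `𝒮(V′_w^{⊕ n})`
([KudlaRallis1994, §1]; [MoeglinVignerasWaldspurger1987, Chap. 3 IV]).  Its equivariance under the Siegel parabolic `P_Δ = M_Δ N_Δ` of the doubled
group and under the parabolic `P_Y ⊂ U(V′_w)` is, at the level of the fibre integral, nothing but the behaviour of `a ↦ ∫ f (Sum.elim a b) dμ(b)`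
(`μ` a Haar measure on the fibre `κ → F`) under substitutions `f ↦ f ∘ T` with `T` BLOCK LOWER-TRIANGULAR for the splitting `ι ⊕ κ`
(base `ι`, fibre `κ`): `T (Sum.elim a b) = Sum.elim (A a) (D b + C a)`.  This file proves exactly that, generically:

* §1 (any additive group fibre, right-invariant `μ`) `integral_sumElim_add_right` — translating the fibre variable changes nothing;
  `integral_sumElim_mul_of_base` — a factor depending only on the base comes out of the integral.
* §2 (locally compact fibre, Haar `μ`) `integral_sumElim_comp_continuousAddEquiv` — a topological automorphism `D` of the fibre costs the module
  `(addEquivAddHaarChar D)⁻¹`; `integral_sumElim_comp_continuousAddEquiv_add` — the affine form `b ↦ D b + c`.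
* §3 (fibre `κ → K`, `K` a non-archimedean local field, MATRIX form) `integral_comp_fromBlocks_mulVec` —
  `∫ f (fromBlocks A 0 C D *ᵥ Sum.elim a b) dμ(b) = ‖det D‖_K⁻¹ • ∫ f (Sum.elim (A *ᵥ a) b) dμ(b)` (★ `addEquivAddHaarChar_mulVec_eq_normAbs`);
  `integral_comp_fromBlocks_mulVec_of_normAbs_eq_one` — the unimodular case (`‖det D‖_K = 1`, e.g. `D` unipotent or in `GL(𝒪)`).

HONEST LABEL: HC_CM is proved only modulo the printed citations (2 remaining named inputs: hLiu418 = stmt-HodgeConjecture-24832, h413 = stmt-HodgeConjecture-24833)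
until rung 0 closes; generic bookkeeping, closes no item.

References: [KudlaRallis1994] S. Kudla, S. Rallis, Ann. of Math. 140 (1994), §1; [MoeglinVignerasWaldspurger1987] Chap. 2 I.4, Chap. 3 IV;
[Weil1964] A. Weil, Acta Math. 111 (1964), n° 11; [WeilBNT1967] A. Weil, Basic Number Theory, Ch. I §2 Prop. 2 Cor. 3 (the module of `x ↦ A x` is `mod_K(det A)`).
-/

set_option autoImplicit false
set_option linter.dupNamespace false -- the mandated namespace repeats `HodgeConjecture.HodgeConjecture`

noncomputable section

open MeasureTheory MeasureTheory.Measure Matrix Topology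
open scoped NNReal ENNReal
open Literature.NumberTheory.GaloisRepresentations.IsNonarchimedeanLocalField
open Literature.NumberTheory.Automorphic
open Summit.HodgeConjecture.HodgeConjecture.Cruxes.HLiu418.K2LiuLocalMatrixHaarChar

namespace Summit.HodgeConjecture.HodgeConjecture.Cruxes.HLiu418.K2LiuFiberIntegralSubstitution

/-! ## §1 Translations of the fibre variable; base-only factors -/

section Translate

variable {G : Type*} [AddGroup G] [MeasurableSpace G] [MeasurableAdd G] (μ : Measure G) [μ.IsAddRightInvariant]
  {ι κ F : Type*} {E : Type*} [NormedAddCommGroup E] [NormedSpace ℝ E]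

/-- **translating the fibre variable changes nothing** (right-invariance of `μ`): `∫ g (b + c) dμ(b) = ∫ g b dμ(b)`, in the shape met by the
fibre integral. [cite: Weil1964, n° 11] -/
theorem integral_comp_add_right (g : G → E) (c : G) : ∫ b, g (b + c) ∂μ = ∫ b, g b ∂μ :=
  integral_add_right_eq_self g c

end Translate

section SumElim

variable {F : Type*} [AddGroup F] {ι κ : Type*} [MeasurableSpace (κ → F)] [MeasurableAdd (κ → F)] (μ : Measure (κ → F))
  [μ.IsAddRightInvariant] {E : Type*} [NormedAddCommGroup E] [NormedSpace ℝ E]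

/-- **the fibre integral is blind to translations of the fibre** (the `N_Y`-shears `x ↦ x + S(w)` of the mixed model):
`∫ f (Sum.elim a (b + c)) dμ(b) = ∫ f (Sum.elim a b) dμ(b)`. [cite: KudlaRallis1994, §1] [cite: Weil1964, n° 11] -/
theorem integral_sumElim_add_right (f : (ι ⊕ κ → F) → E) (a : ι → F) (c : κ → F) :
    ∫ b, f (Sum.elim a (b + c)) ∂μ = ∫ b, f (Sum.elim a b) ∂μ :=
  integral_add_right_eq_self (fun b => f (Sum.elim a b)) c

/-- the same with the translation written on the total space: `Sum.elim a b + Sum.elim 0 c = Sum.elim a (b + c)`. [cite: Weil1964, n° 11] -/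
theorem integral_add_sumElim_zero (f : (ι ⊕ κ → F) → E) (a : ι → F) (c : κ → F) :
    ∫ b, f (Sum.elim a b + Sum.elim (0 : ι → F) c) ∂μ = ∫ b, f (Sum.elim a b) ∂μ := by
  have h : ∀ b : κ → F, Sum.elim a b + Sum.elim (0 : ι → F) c = Sum.elim a (b + c) := by
    intro b
    ext i
    rcases i with i | i
    · simp
    · simp
  simp_rw [h]
  exact integral_sumElim_add_right μ f a c

omit [MeasurableAdd (κ → F)] [μ.IsAddRightInvariant] in
/-- **a factor depending only on the base comes out** (the `N_Δ`-characters `ψ(q(x))` of the mixed model, `q` constant along the fibre over `Y = 0`):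
if `χ (Sum.elim a b) = χ (Sum.elim a 0)` for all `b`, then `∫ χ · f = χ(Sum.elim a 0) · ∫ f` along the fibre. [cite: KudlaRallis1994, §1] -/
theorem integral_sumElim_mul_of_base (χ : (ι ⊕ κ → F) → ℂ) (f : (ι ⊕ κ → F) → ℂ) (a : ι → F)
    (hχ : ∀ b, χ (Sum.elim a b) = χ (Sum.elim a 0)) :
    ∫ b, χ (Sum.elim a b) * f (Sum.elim a b) ∂μ = χ (Sum.elim a 0) * ∫ b, f (Sum.elim a b) ∂μ := by
  simp_rw [hχ]
  exact integral_const_mul _ _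

end SumElim

/-! ## §2 Topological automorphisms of the fibre: the module `addEquivAddHaarChar` -/

section HaarChar

variable {G : Type*} [AddCommGroup G] [TopologicalSpace G] [IsTopologicalAddGroup G] [LocallyCompactSpace G] [MeasurableSpace G]
  [BorelSpace G] (μ : Measure G) [μ.IsAddHaarMeasure] [μ.Regular] {E : Type*} [NormedAddCommGroup E] [NormedSpace ℝ E]

/-- **change of variables along a topological automorphism of a locally compact abelian group**: `∫ g (D b) dμ(b) = χ(D)⁻¹ • ∫ g dμ`,
`χ = addEquivAddHaarChar` (Mathlib: `χ(D) • μ.map D = μ`). [cite: WeilBNT1967, Ch. I §2 Prop. 2] -/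
theorem integral_comp_continuousAddEquiv (D : G ≃ₜ+ G) (g : G → E) :
    ∫ b, g (D b) ∂μ = ((addEquivAddHaarChar D)⁻¹ : ℝ≥0) • ∫ b, g b ∂μ := by
  have hmap : μ.map D = ((addEquivAddHaarChar D)⁻¹ : ℝ≥0) • μ := by
    have h := addEquivAddHaarChar_smul_map μ D
    have hne : addEquivAddHaarChar D ≠ 0 := (addEquivAddHaarChar_pos D).ne'
    calc μ.map D = ((addEquivAddHaarChar D)⁻¹ * addEquivAddHaarChar D : ℝ≥0) • μ.map D := by
          rw [inv_mul_cancel₀ hne, one_smul]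
      _ = ((addEquivAddHaarChar D)⁻¹ : ℝ≥0) • μ := by rw [mul_smul, h]
  have hint : ∫ b, g (D b) ∂μ = ∫ b, g b ∂(μ.map D) := by
    rw [show (⇑D : G → G) = ⇑D.toHomeomorph.toMeasurableEquiv from rfl]
    exact (integral_map_equiv (μ := μ) D.toHomeomorph.toMeasurableEquiv g).symm
  rw [hint, hmap, integral_smul_nnreal_measure]

/-- **the affine form**: `∫ g (D b + c) dμ(b) = χ(D)⁻¹ • ∫ g dμ`. [cite: WeilBNT1967, Ch. I §2 Prop. 2] -/
theorem integral_comp_continuousAddEquiv_add (D : G ≃ₜ+ G) (g : G → E) (c : G) :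
    ∫ b, g (D b + c) ∂μ = ((addEquivAddHaarChar D)⁻¹ : ℝ≥0) • ∫ b, g b ∂μ := by
  rw [integral_comp_continuousAddEquiv μ D (fun b => g (b + c))]
  congr 1
  exact integral_add_right_eq_self g c

variable {ι F : Type*}

/-- **the fibre integral along `Sum.elim` under an affine automorphism of the fibre**: for `D` a topological automorphism of the fibre `G` and any
translation `c`, `∫ f (Sum.elim a (D b + c)) dμ(b) = χ(D)⁻¹ • ∫ f (Sum.elim a b) dμ(b)` — the `M_Δ` ∕ Levi-of-`P_Y` bookkeeping of the mixed model.
[cite: KudlaRallis1994, §1] [cite: WeilBNT1967, Ch. I §2 Prop. 2] -/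
theorem integral_sumElim_comp_continuousAddEquiv_add {κ : Type*} {F : Type*} [AddCommGroup F] [TopologicalSpace F] [IsTopologicalAddGroup F]
    [LocallyCompactSpace (κ → F)] [MeasurableSpace (κ → F)] [BorelSpace (κ → F)] (ν : Measure (κ → F)) [ν.IsAddHaarMeasure] [ν.Regular]
    (f : (ι ⊕ κ → F) → E) (a : ι → F) (D : (κ → F) ≃ₜ+ (κ → F)) (c : κ → F) :
    ∫ b, f (Sum.elim a (D b + c)) ∂ν = ((addEquivAddHaarChar D)⁻¹ : ℝ≥0) • ∫ b, f (Sum.elim a b) ∂ν :=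
  integral_comp_continuousAddEquiv_add ν D (fun b => f (Sum.elim a b)) c

end HaarChar

/-! ## §3 Matrix form over a non-archimedean local field: block lower-triangular substitutions -/

section MatrixIdentity

variable {R : Type*} [NonUnitalNonAssocSemiring R] {ι κ : Type*} [Fintype ι] [Fintype κ]

/-- `fromBlocks A 0 C D *ᵥ Sum.elim a b = Sum.elim (A *ᵥ a) (D *ᵥ b + C *ᵥ a)` — a block lower-triangular matrix moves the fibre affinely.
[cite: KudlaRallis1994, §1] -/
theorem fromBlocks_zero_mulVec_sumElim (A : Matrix ι ι R) (C : Matrix κ ι R) (D : Matrix κ κ R) (a : ι → R) (b : κ → R) :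
    Matrix.fromBlocks A 0 C D *ᵥ Sum.elim a b = Sum.elim (A *ᵥ a) (D *ᵥ b + C *ᵥ a) := by
  rw [Matrix.fromBlocks_mulVec, Sum.elim_comp_inl, Sum.elim_comp_inr, Matrix.zero_mulVec, add_zero, add_comm (C *ᵥ a)]

end MatrixIdentity

section LocalField

variable {K : Type*} [Field K] [ValuativeRel K] [TopologicalSpace K] [IsNonarchimedeanLocalField K] [MeasurableSpace K] [BorelSpace K]
  [SecondCountableTopology K] {ι κ : Type*} [Fintype ι] [Fintype κ] [DecidableEq κ]
  [MeasurableSpace (κ → K)] [BorelSpace (κ → K)] (μ : Measure (κ → K)) [μ.IsAddHaarMeasure]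
  {E : Type*} [NormedAddCommGroup E] [NormedSpace ℝ E]

/-- **MATRIX FORM OF THE LEVI ∕ UNIPOTENT BOOKKEEPING**: for `A ∈ M_ι(K)`, `C`, and `D ∈ GL_κ(K)`,
`∫ f (fromBlocks A 0 C D *ᵥ Sum.elim a b) dμ(b) = ‖det D‖_K⁻¹ • ∫ f (Sum.elim (A *ᵥ a) b) dμ(b)` (`μ` any Haar measure on `K^κ`; the module of
`b ↦ D b` is `‖det D‖_K`, ★ `addEquivAddHaarChar_mulVec_eq_normAbs`). [cite: WeilBNT1967, Ch. I §2 Prop. 2 Cor. 3] [cite: KudlaRallis1994, §1] -/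
theorem integral_comp_fromBlocks_mulVec (f : (ι ⊕ κ → K) → E) (A : Matrix ι ι K) (C : Matrix κ ι K) (D : Matrix κ κ K) (hD : IsUnit D.det)
    (a : ι → K) :
    ∫ b, f (Matrix.fromBlocks A 0 C D *ᵥ Sum.elim a b) ∂μ = ((normAbs K D.det)⁻¹ : ℝ≥0) • ∫ b, f (Sum.elim (A *ᵥ a) b) ∂μ := by
  -- the Borel σ-algebra carried as an instance hypothesis IS the product σ-algebra (second countability): align the instances
  have hms : ‹MeasurableSpace (κ → K)› = MeasurableSpace.pi :=
    (BorelSpace.measurable_eq (α := κ → K)).trans (@BorelSpace.measurable_eq (κ → K) _ MeasurableSpace.pi _).symm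
  subst hms
  obtain ⟨L, hL⟩ := exists_continuousAddEquiv_mulVec D hD
  simp_rw [fromBlocks_zero_mulVec_sumElim]
  have h := integral_sumElim_comp_continuousAddEquiv_add (E := E) (ι := ι) μ f (A *ᵥ a) L (C *ᵥ a)
  simp_rw [hL] at h
  rw [h]
  congr 2
  convert addEquivAddHaarChar_mulVec_eq_normAbs D hD L hL

/-- **the unimodular case** (`‖det D‖_K = 1`: `D` unipotent, a permutation, or in `GL_κ(𝒪_K)`): the fibre integral is simply transported,
`∫ f (fromBlocks A 0 C D *ᵥ Sum.elim a b) dμ(b) = ∫ f (Sum.elim (A *ᵥ a) b) dμ(b)`. [cite: KudlaRallis1994, §1] -/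
theorem integral_comp_fromBlocks_mulVec_of_normAbs_eq_one (f : (ι ⊕ κ → K) → E) (A : Matrix ι ι K) (C : Matrix κ ι K) (D : Matrix κ κ K)
    (hD : normAbs K D.det = 1) (a : ι → K) :
    ∫ b, f (Matrix.fromBlocks A 0 C D *ᵥ Sum.elim a b) ∂μ = ∫ b, f (Sum.elim (A *ᵥ a) b) ∂μ := by
  have hD' : IsUnit D.det := by
    refine isUnit_iff_ne_zero.2 fun h0 => ?_
    rw [h0, map_zero] at hD
    exact zero_ne_one hD
  rw [integral_comp_fromBlocks_mulVec μ f A C D hD' a, hD, inv_one, one_smul]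

/-- **the pure shear** (`A = 1`, `D = 1`: the unipotent radical `N_Y` of the mixed model, `x ↦ x + C w`):
`∫ f (fromBlocks 1 0 C 1 *ᵥ Sum.elim a b) dμ(b) = ∫ f (Sum.elim a b) dμ(b)`. [cite: KudlaRallis1994, §1] -/
theorem integral_comp_fromBlocks_one_mulVec [DecidableEq ι] (f : (ι ⊕ κ → K) → E) (C : Matrix κ ι K) (a : ι → K) :
    ∫ b, f (Matrix.fromBlocks 1 0 C 1 *ᵥ Sum.elim a b) ∂μ = ∫ b, f (Sum.elim a b) ∂μ := by
  rw [integral_comp_fromBlocks_mulVec_of_normAbs_eq_one μ f 1 C 1 (by rw [Matrix.det_one, map_one]) a, Matrix.one_mulVec]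

end LocalField

end Summit.HodgeConjecture.HodgeConjecture.Cruxes.HLiu418.K2LiuFiberIntegralSubstitution

end
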